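import Summits.BirchSwinnertonDyer.BirchSwinnertonDyer.Theorems.PrintCf2SplitBadTwoWeakLeopoldtOfShaBound
import Summits.BirchSwinnertonDyer.BirchSwinnertonDyer.Theorems.PrintCf2SplitBadTwoRestrictedSelmerEigenProjector
import Summits.BirchSwinnertonDyer.BirchSwinnertonDyer.Theorems.PrintCf2SplitBadTwoRestrictedSelmerNoFiniteSubmoduleOfH2
import Summits.BirchSwinnertonDyer.BirchSwinnertonDyer.Theorems.PrintCf2SplitBadTwoRestrictedSelmerCoinvariantsVanish
import Summits.BirchSwinnertonDyer.BirchSwinnertonDyer.Theorems.PrintCf2SplitBadTwoReductionTypesOverK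
import Summits.BirchSwinnertonDyer.BirchSwinnertonDyer.Theorems.PrintCf2SplitBadTwoInertiaFixedTorsionSharp
import Summits.BirchSwinnertonDyer.Rank1Residual.X11b.RouteR1Coinvariants
import Literature.NumberTheory.QuadraticFields.KroneckerSplitting
import HarnessLib

/-!
# Crux `PrintCf2.SplitBadTwoRankOneOfFacts` (stmt-BirchSwinnertonDyer-20368), road α v10.3, S3c residual (R-TOP) = brick B17, input (α):
# `H²(Γ_K, W*) = 0` ON EVERY S3c FRAME from the finiteness of the two bottom restricted Selmer groups — and (R-TOP) ⟸ the base lift (β)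

Cell `bsd-print-cf2`, EXTRA WIDTH seat `bsd-line-cf2-p1-w4` g9 (prover-bsd-line-cf2-p1-w4-g9-0); `--supports stmt-BirchSwinnertonDyer-20368`
(helper, Theses-free). HONEST FRAMING: nothing here closes the crux or a registered stub; BSD is not proved by any of this; no summit statement
is proved by this seat. No definition, no named fact, no `sorry`. CONDITIONAL on the cited facts `poitouTate_sha_tateDual K` (Harari 17.13 (b) /
Milne I 4.10 (a)) and `fieldCdLE_two_of_numberField` (Serre II §4.4 Prop. 13) — the same two the X11b route takes as hypotheses — and, in §4, on
the displayed BASE LIFT (β) (JSW17 Lemma 3.3.3 second half / Greenberg LNM 1716 pp. 122–125 for Agboola's module; not proved here).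

WHAT. (R-TOP) of LEAD g12's `restrictedControl_two_of_residuals` (p664178) — `#𝔖_Γ = 1` for `𝔖 = 𝔖_{v̄}(K*_∞, W*)`,
`W* = ↥((W.baseChange K).endEigenPrimaryTorsion 2 π r)` — is by p657357 + p663870 the conjunction of (α) `H²(Γ_K, W*) = 0` and (β) the base lift.
THIS FILE PROVES (α) on every S3c frame from: `Finite 𝔖_{v̄}(K, W*)` (hfinB — a CONSEQUENCE of the frame's `HasCharValuationAt`, -w7's
`hasCharValuationAt_control_identity_endEigenPrimaryTorsion`) and `Finite 𝔖_v(K, W*')` for the CONJUGATE summand `W*' = E[𝔮_{1−r}^∞]` with the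
CONJUGATE strict place `v` (hfinB' — the same finiteness for the conjugate frame `(v̄, v, 1 − r)`, i.e. S3b′ there; displayed). Mechanism:
 (1) `Ш¹(K, E[2^∞]) ↪ 𝔖_{v̄}(K, W*) × 𝔖_v(K, W*')` (`finite_sha_primary_of_finite_restrictedSelmerBase`): an everywhere-locally-trivial class lies
     in EVERY Selmer structure (`sha_le_selmerGroup`, `AcSelmer.topEquivH1_mem_selmerAcBase_iff`), in particular in Castella's/Agboola's
     `𝔖_𝔮(K, E[2^∞])` for both `𝔮 ∈ {v, v̄}`; -w7 g2's equivariant eigen-projectors `e, e′` (p662922 `…EigenProjector`) carry these into the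
     summands' groups (`resH1Hom_proj_mem_restrictedSelmer`) and `ι_* e_* c + ι′_* e′_* c = c` (`resH1Hom_subtype_proj_add_eq`) makes the pair
     of projections injective;
 (2) hence `H²(Γ_K, E[2^∞]) = 0` by file 1 (`WeakLeopoldt.subsingleton_galoisCohomology_two_primary_of_finite_sha`, uniform local exponents from
     X11b `exists_pow_nsmul_local_eq_zero` — `2` splits in `K = ℚ(√−7)`);
 (3) `H²(Γ_K, W*) ↪ H²(Γ_K, E[2^∞])` (`subsingleton_H2_endEigen_of_subsingleton_H2_primary`): `H²(e) ∘ H²(ι) = H²(e ∘ ι) = id`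
     (`map_comp_apply_of`, `map_apply_of_id`).
 (4) §4: (R-TOP) in the LEAD's currency ⟸ (β) + hfinB' + the two facts (`natCard_endCoinvariants_eq_one_of_frame_of_baseLift`), via p663870
     `noFiniteSubmodule_of_frame_of_subsingleton_H2_of_baseLift` and LEAD g11's `control_identity_of_frame_of_noFiniteSubmodule`.
WHY hfinB' AND NOT A RANK HYPOTHESIS: `H²(Γ_K, W*) = Ш²(K, W*) ≅ lim Ш¹(K, W*'[2^k])^∨` (local `H²` dies in the limit; Poitou–Tate + Weil isotropy
of the eigen-summands), and `Ш¹(K, W*') ⊆ 𝔖_v(K, W*')`; at an analytic-rank-one member both bottom groups are finite (Agboola Thm. 6.x /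
Rubin's variant), at `𝒪`-rank ≥ 2 both are infinite and (α) FAILS — so the displayed finiteness IS the rank-one input, in the line's own currency.
presearch: JSW17 Lemma 3.3.3 (arXiv:1512.06894 pp. 11–12); Greenberg LNM 1716 §4 pp. 122–125, Prop. 4.14; Agboola 2007 §5 Prop. 5.1, §6 — corpus
held (w4 g8 TURNKEY); no new fact. beyond-print theorem: no.

References: [JetchevSkinnerWan2017] Lemma 3.3.3; [GreenbergLNM1716] §4 Props. 4.13–4.15; [Agboola2007] §5 Prop. 5.1, §6; [Harari2020] Thm. 17.13 (b);
[SerreGaloisCohomology1997] I §2.4, II §4.4 Prop. 13; [Rubin1999] §2.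
-/

noncomputable section

open scoped Classical

set_option linter.dupNamespace false
set_option autoImplicit false

open CategoryTheory NumberField IsDedekindDomain Field WeierstrassCurve
open Literature.NumberTheory.EllipticCurves Literature.NumberTheory.EllipticCurves.GreenbergSelmer
open Literature.NumberTheory.EllipticCurves.Agboola2007
open Literature.NumberTheory.EllipticCurves.IwasawaAlgebra
open Literature.NumberTheory.EllipticCurves.IwasawaDual
open Literature.NumberTheory.GaloisRepresentations
open Literature.NumberTheory.GaloisCohomology
open Summit.BirchSwinnertonDyer.Rank1Residual.X11b
open Summit.BirchSwinnertonDyer.BirchSwinnertonDyer.Theorems.PrintCf2.AdditiveAtSeven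
open Summit.BirchSwinnertonDyer.BirchSwinnertonDyer.Theorems.PrintCf2.ReductionTypesOverK

universe u

namespace Summit.BirchSwinnertonDyer.BirchSwinnertonDyer.Theorems.PrintCf2.RestrictedSelmerPair

/-! ## §1. `Ш¹(K, E[p^∞]) ↪ 𝔖_𝔮(K, E[𝔮^∞]) × 𝔖_{𝔮′}(K, E[𝔮̄^∞])`: finiteness of `Ш¹` from the two summands' bottom groups -/

section ShaFinite

variable {K : Type} [Field K] [NumberField K] (V : WeierstrassCurve K) (p : ℕ) [Fact p.Prime]
  (π : V.endRing) (r r' : ℤ_[p])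

/-- **`Ш¹(K, E[p^∞])` is finite as soon as the two restricted Selmer groups `𝔖_𝔮(K, E[𝔮^∞])`, `𝔖_{𝔮′}(K, E[𝔮̄^∞])` of the complementary
eigen-summands are finite** (any two places `𝔮`, `𝔮′`; equivariant projectors `e`, `e′` with `ι e + ι′ e′ = id`): an everywhere locally trivial
class lies in every Selmer structure, in particular in `𝔖_𝔮(K, E[p^∞])` and `𝔖_{𝔮′}(K, E[p^∞])`; project with `e_*`, `e′_*`
(`resH1Hom_proj_mem_restrictedSelmer`); the pair of projections is injective by the splitting `ι_* e_* c + ι′_* e′_* c = c`.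
[cite: SerreGaloisCohomology1997, I §2.4] [cite: Agboola2007, §3 and §6] -/
theorem finite_sha_primary_of_finite_restrictedSelmerBase (𝔮 𝔮' : HeightOneSpectrum (𝓞 K))
    (e : V.geomPrimaryTorsion p →+ ↥(V.endEigenPrimaryTorsion p π r))
    (e' : V.geomPrimaryTorsion p →+ ↥(V.endEigenPrimaryTorsion p π r'))
    (he : ∀ (σ : absoluteGaloisGroup K) (x : V.geomPrimaryTorsion p), e (σ • x) = σ • e x)
    (he' : ∀ (σ : absoluteGaloisGroup K) (x : V.geomPrimaryTorsion p), e' (σ • x) = σ • e' x)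
    (hsum : ∀ x, (e x : V.geomPrimaryTorsion p) + (e' x : V.geomPrimaryTorsion p) = x)
    [Finite (restrictedSelmerBase ↥(V.endEigenPrimaryTorsion p π r) p 𝔮)]
    [Finite (restrictedSelmerBase ↥(V.endEigenPrimaryTorsion p π r') p 𝔮')] :
    Finite (LocBridge.primaryGaloisModule V p).sha := by
  let t := LocBridge.topEquivH1 (LocBridge.isOpen_stabilizer_geomPrimaryTorsion V p)
  have hmem : ∀ (𝔫 : HeightOneSpectrum (𝓞 K)) (x : (LocBridge.primaryGaloisModule V p).sha),
      t x.1 ∈ restrictedSelmerBase (V.geomPrimaryTorsion p) p 𝔫 := fun 𝔫 x ↦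
    (Summit.BirchSwinnertonDyer.Rank1Residual.X11b.AcSelmer.topEquivH1_mem_selmerAcBase_iff V p 𝔫 ∅ x.1).mpr
      (DiscreteGaloisModule.sha_le_selmerGroup _ _ x.2)
  let f : (LocBridge.primaryGaloisModule V p).sha →
      restrictedSelmerBase ↥(V.endEigenPrimaryTorsion p π r) p 𝔮 × restrictedSelmerBase ↥(V.endEigenPrimaryTorsion p π r') p 𝔮' :=
    fun x ↦ (⟨resH1Hom (ContinuousMonoidHom.id (⊤ : Subgroup (absoluteGaloisGroup K))) e (fun σ y ↦ he σ y) (t x.1),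
        resH1Hom_proj_mem_restrictedSelmer V p π r ⊤ 𝔮 e he (hmem 𝔮 x)⟩,
      ⟨resH1Hom (ContinuousMonoidHom.id (⊤ : Subgroup (absoluteGaloisGroup K))) e' (fun σ y ↦ he' σ y) (t x.1),
        resH1Hom_proj_mem_restrictedSelmer V p π r' ⊤ 𝔮' e' he' (hmem 𝔮' x)⟩)
  refine Finite.of_injective f fun x y hxy ↦ ?_
  have h1 := congrArg (fun z ↦ ((z.1 : restrictedSelmerBase ↥(V.endEigenPrimaryTorsion p π r) p 𝔮) :
    subgroupH1 (⊤ : Subgroup (absoluteGaloisGroup K)) ↥(V.endEigenPrimaryTorsion p π r))) hxy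
  have h2 := congrArg (fun z ↦ ((z.2 : restrictedSelmerBase ↥(V.endEigenPrimaryTorsion p π r') p 𝔮') :
    subgroupH1 (⊤ : Subgroup (absoluteGaloisGroup K)) ↥(V.endEigenPrimaryTorsion p π r'))) hxy
  simp only [f] at h1 h2
  have hx := resH1Hom_subtype_proj_add_eq V p π r r' ⊤ e e' he he' hsum (t x.1)
  have hy := resH1Hom_subtype_proj_add_eq V p π r r' ⊤ e e' he he' hsum (t y.1)
  rw [h1, h2, hy] at hx
  exact Subtype.ext (t.injective hx.symm)

end ShaFinite

/-! ## §2. `H²(Γ_K, E[𝔮^∞]) ↪ H²(Γ_K, E[p^∞])`: the summand transport in degree `2` -/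

section Transport

variable {K : Type} [Field K] (V : WeierstrassCurve K) (p : ℕ) [Fact p.Prime] (π : V.endRing) (r : ℤ_[p])

/-- **`H²(Γ_K, E[p^∞]) = 0 ⟹ H²(Γ_K, E[𝔮^∞]) = 0`** for an eigen-summand with an equivariant projector `e` (`e ∘ ι = id`): on classes
`H²(e) (H²(ι) z) = H²(e ∘ ι) z = z` (functoriality of continuous cohomology in compatible pairs, `map_comp_apply_of`, `map_apply_of_id`), so
`H²(ι)` is injective. [cite: SerreGaloisCohomology1997, I §2.4] -/
theorem subsingleton_H2_endEigen_of_subsingleton_H2_primary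
    (e : V.geomPrimaryTorsion p →+ ↥(V.endEigenPrimaryTorsion p π r)) (he₁ : ∀ x : ↥(V.endEigenPrimaryTorsion p π r), e x = x)
    (he : ∀ (σ : absoluteGaloisGroup K) (x : V.geomPrimaryTorsion p), e (σ • x) = σ • e x)
    (h2 : Subsingleton (continuousCohomology 2 (discreteTopRep (absoluteGaloisGroup K) (V.geomPrimaryTorsion p)))) :
    Subsingleton (continuousCohomology 2 (discreteTopRep (absoluteGaloisGroup K) ↥(V.endEigenPrimaryTorsion p π r))) := by
  let G := absoluteGaloisGroup K
  let ιh := resHomOfEquivariant (ContinuousMonoidHom.id G) (V.endEigenPrimaryTorsion p π r).subtype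
    (N := V.geomPrimaryTorsion p) (fun _ _ ↦ rfl)
  let eh := resHomOfEquivariant (ContinuousMonoidHom.id G) e (N := ↥(V.endEigenPrimaryTorsion p π r)) (fun σ x ↦ he σ x)
  let ch := resHomOfEquivariant (ContinuousMonoidHom.id G) (e.comp (V.endEigenPrimaryTorsion p π r).subtype)
    (N := ↥(V.endEigenPrimaryTorsion p π r)) (fun σ x ↦ by
      change e ((σ • x : ↥(V.endEigenPrimaryTorsion p π r)) : V.geomPrimaryTorsion p) = σ • e x
      rw [WeierstrassCurve.endEigenPrimaryTorsion.coe_smul, he])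
  have key : ∀ z : continuousCohomology 2 (discreteTopRep G ↥(V.endEigenPrimaryTorsion p π r)),
      z = ContinuousCohomology.map (ContinuousMonoidHom.id G) eh 2 (ContinuousCohomology.map (ContinuousMonoidHom.id G) ιh 2 z) := by
    intro z
    rw [← map_comp_apply_of (ContinuousMonoidHom.id G) (ContinuousMonoidHom.id G) (ContinuousMonoidHom.id G) (fun _ ↦ rfl) ιh eh ch
      (fun _ ↦ rfl) 2 z, map_apply_of_id (ContinuousMonoidHom.id G) (fun _ ↦ rfl) ch (fun v ↦ he₁ v) 2 z]
  refine ⟨fun z z' ↦ ?_⟩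
  rw [key z, key z', Subsingleton.elim (ContinuousCohomology.map (ContinuousMonoidHom.id G) ιh 2 z)
    (ContinuousCohomology.map (ContinuousMonoidHom.id G) ιh 2 z')]

end Transport

/-! ## §3. Road α: `H²(Γ_K, W*) = 0` on every S3c frame from hfinB (this frame) and hfinB' (the conjugate frame) -/

section Frame

variable {K : Type} [Field K] [NumberField K]

/-- **`Ш¹(K, W_K[2^∞])` is finite on the S3c frame** when `𝔖_{v̄}(K, W*)` and `𝔖_v(K, W*')` are (`W* = E[𝔮_r^∞]`, `W*' = E[𝔮_{1−r}^∞]`;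
-w7 g2's `exists_eigenProjector_two` twice, complementarity by -w2 g7's `CMPrimes.endEigenPrimaryTorsion_two_structure`).
[cite: Agboola2007, §3 and §6] [cite: Rubin1999, §2] -/
theorem finite_sha_primary_of_frame {d : ℤ} (hd0 : d ≠ 0) (W : WeierstrassCurve ℚ) [W.IsElliptic] (C : VariableChange ℚ)
    (hC : C • W = cm7.quadraticTwist (d : ℚ)) {θ : K} (hθ : θ ^ 2 = -7) (v vbar : HeightOneSpectrum (𝓞 K))
    (π : (W.baseChange K).endRing) (hrel : (π : AddMonoid.End (W.baseChange K).geomPoints) * π = π - 2) {r : ℤ_[2]} (hr : r * r = r - 2)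
    [Finite (restrictedSelmerBase ↥((W.baseChange K).endEigenPrimaryTorsion 2 π r) 2 vbar)]
    [Finite (restrictedSelmerBase ↥((W.baseChange K).endEigenPrimaryTorsion 2 π (1 - r)) 2 v)] :
    Finite (LocBridge.primaryGaloisModule (W.baseChange K) 2).sha := by
  haveI : Fact (Nat.Prime 2) := ⟨Nat.prime_two⟩
  haveI : (W.baseChange K).IsElliptic := by rw [baseChange]; infer_instance
  have hj : W.j = -3375 := j_eq_of_smul_eq_cm7Twist hd0 W C hC
  have hr' : (1 - r) * (1 - r) = (1 - r) - 2 := by linear_combination hr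
  obtain ⟨e, he₁, he₂, hesub, he⟩ := exists_eigenProjector_two W hj K hθ π hrel hr
  obtain ⟨e', he₁', he₂', -, he'⟩ := exists_eigenProjector_two W hj K hθ π hrel hr'
  rw [sub_sub_cancel] at he₂'
  have hsum : ∀ x, (e x : (W.baseChange K).geomPrimaryTorsion 2) + (e' x : (W.baseChange K).geomPrimaryTorsion 2) = x := by
    intro x
    have h1 : ((e' (x - (e x : (W.baseChange K).geomPrimaryTorsion 2)) : (W.baseChange K).geomPrimaryTorsion 2)) =
        x - (e x : (W.baseChange K).geomPrimaryTorsion 2) := by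
      have := he₁' ⟨x - (e x : (W.baseChange K).geomPrimaryTorsion 2), hesub x⟩
      exact congrArg Subtype.val this
    have h2 : e' (e x : (W.baseChange K).geomPrimaryTorsion 2) = 0 := he₂' _ (e x).2
    have h3 : e' x = e' (x - (e x : (W.baseChange K).geomPrimaryTorsion 2)) + e' (e x : (W.baseChange K).geomPrimaryTorsion 2) := by
      rw [← map_add, sub_add_cancel]
    rw [h3, h2, add_zero, h1, add_sub_cancel]
  exact finite_sha_primary_of_finite_restrictedSelmerBase (W.baseChange K) 2 π r (1 - r) vbar v e e' he he' hsum

/-- **`H²(Γ_K, W*) = 0` ON EVERY S3c FRAME** (`W* = ↥((W.baseChange K).endEigenPrimaryTorsion 2 π r)`, `C • W = cm7^{(d)}`, `K` imaginary quadratic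
carrying the `K`-rational `π² = π − 2`, `r² = r − 2`) from the finiteness of `𝔖_{v̄}(K, W*)` (hfinB) and of `𝔖_v(K, W*')` (hfinB', the conjugate
frame), GRANTED the cited facts `poitouTate_sha_tateDual K` and `fieldCdLE_two_of_numberField`: §1 + file 1 + §2, with uniform local exponents from
X11b's `exists_pow_nsmul_local_eq_zero` (`2` splits in `K`, `d_K = −7`; its `[W.IsGloballyMinimal]` binder — an S3c binder — is carried). This is hypothesis `h2` of -w4 g8's
`noFiniteSubmodule_of_frame_of_subsingleton_H2_of_baseLift` (p663870). [cite: JetchevSkinnerWan2017, Lemma 3.3.3 (arXiv:1512.06894 pp. 11–12)]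
[cite: GreenbergLNM1716, §4 Props. 4.13–4.15] [cite: Harari2020, Thm. 17.13 (b)] -/
theorem subsingleton_H2_endEigenPrimaryTorsion_of_frame {d : ℤ} (hd0 : d ≠ 0) (W : WeierstrassCurve ℚ) [W.IsElliptic]
    [W.IsGloballyMinimal] (C : VariableChange ℚ) (hC : C • W = cm7.quadraticTwist (d : ℚ)) (hK : IsImaginaryQuadratic K) (v vbar : HeightOneSpectrum (𝓞 K))
    (π : (W.baseChange K).endRing) (hrel : (π : AddMonoid.End (W.baseChange K).geomPoints) * π = π - 2) {r : ℤ_[2]} (hr : r * r = r - 2)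
    (hPT : poitouTate_sha_tateDual K) (hcd : fieldCdLE_two_of_numberField)
    (hfin : Finite (restrictedSelmerBase ↥((W.baseChange K).endEigenPrimaryTorsion 2 π r) 2 vbar))
    (hfin' : Finite (restrictedSelmerBase ↥((W.baseChange K).endEigenPrimaryTorsion 2 π (1 - r)) 2 v)) :
    Subsingleton (continuousCohomology 2
      (discreteTopRep (absoluteGaloisGroup K) ↥((W.baseChange K).endEigenPrimaryTorsion 2 π r))) := by
  haveI : Fact (Nat.Prime 2) := ⟨Nat.prime_two⟩
  haveI : (W.baseChange K).IsElliptic := by rw [baseChange]; infer_instance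
  haveI : IsTotallyComplex K := hK.2
  haveI := hfin
  haveI := hfin'
  have hj : W.j = -3375 := j_eq_of_smul_eq_cm7Twist hd0 W C hC
  obtain ⟨θ, hθ⟩ := exists_sq_eq_neg_seven_of_cmEndo_mem_endRing W K hj π hrel
  -- `2` splits in `K` (`d_K = −7 ≡ 1 (8)`): uniform local exponents
  have hdK := discr_eq_neg_seven_of_sq_eq K hK hθ hd0 W hC
  have hs : SplitsIn K 2 := by
    unfold SplitsIn
    rw [Nat.cast_ofNat, Literature.NumberTheory.QuadraticFields.Quadratic.ncard_primesOver_two_eq_two_iff hK.1, hdK]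
    decide
  have htor := exists_pow_nsmul_local_eq_zero W 2 hK.1 hs
  -- `Ш¹(K, E[2^∞])` finite ⟹ `H²(Γ_K, E[2^∞]) = 0` ⟹ `H²(Γ_K, W*) = 0`
  haveI := finite_sha_primary_of_frame hd0 W C hC hθ v vbar π hrel hr
  have h2 := WeakLeopoldt.subsingleton_galoisCohomology_two_primary_of_finite_sha (W.baseChange K) 2 hPT
    (fieldCdLE_two_of_isTotallyComplex hcd K 2) htor
  obtain ⟨e, he₁, -, -, he⟩ := exists_eigenProjector_two W hj K hθ π hrel hr
  exact subsingleton_H2_endEigen_of_subsingleton_H2_primary (W.baseChange K) 2 π r e he₁ he h2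

end Frame

/-! ## §4. (R-TOP) of p664178 ⟸ the base lift (β), on every S3c frame -/

section RTop

variable {K : Type} [Field K] [NumberField K]

/-- **B17 `hY` on every S3c frame ⟸ (β) base lift + hfinB + hfinB' + the two cited facts**: p663870's
`noFiniteSubmodule_of_frame_of_subsingleton_H2_of_baseLift` with its `h2` DISCHARGED by §3.
[cite: JetchevSkinnerWan2017, Lemma 3.3.3] [cite: GreenbergLNM1716, §4 Props. 4.14–4.15] [cite: Agboola2007, §5 Prop. 5.1] -/
theorem noFiniteSubmodule_of_frame_of_baseLift {d : ℤ} (hd0 : d ≠ 0) (W : WeierstrassCurve ℚ) [W.IsElliptic]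
    [W.IsGloballyMinimal] (C : VariableChange ℚ) (hC : C • W = cm7.quadraticTwist (d : ℚ)) (hK : IsImaginaryQuadratic K) (v vbar : HeightOneSpectrum (𝓞 K))
    (π : (W.baseChange K).endRing) (hrel : (π : AddMonoid.End (W.baseChange K).geomPoints) * π = π - 2) {r : ℤ_[2]} (hr : r * r = r - 2)
    (κ' : ZpExtension K 2) {γ' : absoluteGaloisGroup K} (hγ' : κ'.IsTopGenerator γ')
    (D : RestrictedDualData κ' ↥((W.baseChange K).endEigenPrimaryTorsion 2 π r) vbar γ')
    (hPT : poitouTate_sha_tateDual K) (hcd : fieldCdLE_two_of_numberField)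
    (hfin : Finite (restrictedSelmerBase ↥((W.baseChange K).endEigenPrimaryTorsion 2 π r) 2 vbar))
    (hfin' : Finite (restrictedSelmerBase ↥((W.baseChange K).endEigenPrimaryTorsion 2 π (1 - r)) 2 v))
    (hbase : ∀ c : subgroupH1 κ'.kerSubgroup ↥((W.baseChange K).endEigenPrimaryTorsion 2 π r),
      conjH1 κ'.kerSubgroup ↥((W.baseChange K).endEigenPrimaryTorsion 2 π r) γ' c - c ∈
          restrictedSelmerZp κ' ↥((W.baseChange K).endEigenPrimaryTorsion 2 π r) vbar →
        ∃ z : subgroupH1 (⊤ : Subgroup (absoluteGaloisGroup K)) ↥((W.baseChange K).endEigenPrimaryTorsion 2 π r),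
          c - resOfLe ↥((W.baseChange K).endEigenPrimaryTorsion 2 π r) (le_top : κ'.kerSubgroup ≤ ⊤) z ∈
            restrictedSelmerZp κ' ↥((W.baseChange K).endEigenPrimaryTorsion 2 π r) vbar) :
    ∀ N : Submodule (IwasawaAlgebra 2) D.X, Finite N → N = ⊥ :=
  noFiniteSubmodule_of_frame_of_subsingleton_H2_of_baseLift W π r κ' hγ' vbar D
    (subsingleton_H2_endEigenPrimaryTorsion_of_frame hd0 W C hC hK v vbar π hrel hr hPT hcd hfin hfin') hbase

/-- **(R-TOP) of `restrictedControl_two_of_residuals` (p664178) ⟸ (β)**, in the LEAD's currency: on every S3c frame carrying a finitely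
generated dual datum with `HasCharValuationAt n`, `#𝔖_Γ = 1` — GRANTED the base lift (β) for `𝔖_{v̄}(K*_∞, W*)`, the conjugate bottom
finiteness hfinB' `Finite 𝔖_v(K, W*')` (S3b′ at the conjugate frame), and the two cited facts. hfinB itself comes from `HasCharValuationAt`
(-w7's `hasCharValuationAt_control_identity_endEigenPrimaryTorsion`); the conclusion is LEAD g11's `control_identity_of_frame_of_noFiniteSubmodule`
(p657357) fed with `hY`. (The pinning clause and `v ≠ v̄`, `2 ∈ v, v̄` of the (R-TOP) binder list are not used.)
[cite: Agboola2007, §5 Prop. 5.1 and §6] [cite: GreenbergLNM1716, §4 Props. 4.14–4.15] [cite: JetchevSkinnerWan2017, Lemma 3.3.3] -/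
theorem natCard_endCoinvariants_eq_one_of_frame_of_baseLift {d : ℤ} (hd0 : d ≠ 0) (W : WeierstrassCurve ℚ) [W.IsElliptic]
    [W.IsGloballyMinimal] (C : VariableChange ℚ) (hC : C • W = cm7.quadraticTwist (d : ℚ)) (hK : IsImaginaryQuadratic K) (v vbar : HeightOneSpectrum (𝓞 K))
    (hvbar : ((2 : ℕ) : 𝓞 K) ∈ vbar.asIdeal)
    (π : (W.baseChange K).endRing) (hrel : (π : AddMonoid.End (W.baseChange K).geomPoints) * π = π - 2) {r : ℤ_[2]} (hr : r * r = r - 2)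
    (κ' : ZpExtension K 2) (hκ' : κ'.IsUnramifiedOutside vbar) {γ' : absoluteGaloisGroup K} (hγ' : κ'.IsTopGenerator γ')
    (D : RestrictedDualData κ' ↥((W.baseChange K).endEigenPrimaryTorsion 2 π r) vbar γ') {n : ℕ}
    (hDf : Module.Finite (IwasawaAlgebra 2) D.X) (hDn : D.HasCharValuationAt n)
    (hPT : poitouTate_sha_tateDual K) (hcd : fieldCdLE_two_of_numberField)
    (hfin' : Finite (restrictedSelmerBase ↥((W.baseChange K).endEigenPrimaryTorsion 2 π (1 - r)) 2 v))
    (hbase : ∀ c : subgroupH1 κ'.kerSubgroup ↥((W.baseChange K).endEigenPrimaryTorsion 2 π r),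
      conjH1 κ'.kerSubgroup ↥((W.baseChange K).endEigenPrimaryTorsion 2 π r) γ' c - c ∈
          restrictedSelmerZp κ' ↥((W.baseChange K).endEigenPrimaryTorsion 2 π r) vbar →
        ∃ z : subgroupH1 (⊤ : Subgroup (absoluteGaloisGroup K)) ↥((W.baseChange K).endEigenPrimaryTorsion 2 π r),
          c - resOfLe ↥((W.baseChange K).endEigenPrimaryTorsion 2 π r) (le_top : κ'.kerSubgroup ≤ ⊤) z ∈
            restrictedSelmerZp κ' ↥((W.baseChange K).endEigenPrimaryTorsion 2 π r) vbar) :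
    Nat.card (EndCoinvariants
      (conjRestricted κ' ↥((W.baseChange K).endEigenPrimaryTorsion 2 π r) vbar γ' - 1)) = 1 := by
  haveI : Fact (Nat.Prime 2) := ⟨Nat.prime_two⟩
  haveI : (W.baseChange K).IsElliptic := by rw [baseChange]; infer_instance
  haveI := hDf
  have hj : W.j = -3375 := j_eq_of_smul_eq_cm7Twist hd0 W C hC
  obtain ⟨θ, hθ⟩ := exists_sq_eq_neg_seven_of_cmEndo_mem_endRing W K hj π hrel
  obtain ⟨-, -, hfinB, -, -⟩ := hasCharValuationAt_control_identity_endEigenPrimaryTorsion (W.baseChange K) 2 π r κ' hγ' vbar D hDn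
  have hY := noFiniteSubmodule_of_frame_of_baseLift hd0 W C hC hK v vbar π hrel hr κ' hγ' D hPT hcd hfinB hfin' hbase
  exact (control_identity_of_frame_of_noFiniteSubmodule hd0 W C hC hK hθ vbar hvbar π hrel hr κ' hκ' hγ' D hDn hY).1

end RTop

end Summit.BirchSwinnertonDyer.BirchSwinnertonDyer.Theorems.PrintCf2.RestrictedSelmerPair

end
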